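import Mathlib
import HarnessLib
import Summits.HubbardSuperconductivity.HubbardSuperconductivity.Theorems.KLProgrammeKLRegimeEnginePairTransferDLineEdgePinnedFiveSlotTCCSlots

/-!
# Route `KLProgramme` — ENGINE item stmt-HubbardSuperconductivity-20437 `KLRegimeEngineV17F2`, class #5 rev 3 — «88b» THE PINNED PAIR: the five-slot ADAPTER ON
# ANGULAR-CELL DATA, part 2 (cure (A″) of the located «(X).3-COOPER-ANTIPODE-PINNED»): `dLine_pinned_direct_fiveSlotTCC`, `dLine_pinned_crossed_fiveSlotTCC`
# (part 1 = …PinnedFiveSlotTCCSlots: `pinned_row_le_slotsTCC₀/_shiftTCC₀`, `klpc_scaled_div_L_le`, `klpc_defect_le`)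

Cell gate-hubbard-kl, seat hubbard-kl-k3c1-p1 g22 (composed-map remainder propagation).  The (X).3 one-call «95v2» asks, per pinned pair (`1 ≤ n`, `j′ = n+1`), the signed
direct/crossed `D`-rows in the FIVE-SLOT form `(KlamU)²·(z·4^{−(n+1)} + h·4^{−(n_β−n)} + w·2⁻ⁿ + l·L⁻¹ + t·min)`.  The adapters of record (`…fiveSlotS′/TC′/SL/TCL`) fed them from
k3c2-p2's split3 doors with SUP data (global Lipschitz `L₁`, sup flatness `ε₁`, one sign-blind window) — the located COOPER-ANTIPODE interface (pen (R437)/(R448)).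
k3c2-p2 g26's cell door `dLine_pinned_direct/crossed_splitCells_doorTC` (✓ p726872, …DLineEdgeSplitCellsDoorSharpTC) books instead ANGULAR-CELL data: arcs
`[α_c, β_c]` with serving sets `S_c` and cell Lipschitz constants `Lc_c` (arc-weighted sum `I₁ = Σ_c Lc_c(β_c − α_c)`), ONE global Lipschitz constant `K_g` (lattice→continuum
only), the scale-free quasi-Lipschitz defect `I_δ = Σ_c (2Lc_c + 4K_g)(π/L)(β_c − α_c)`, a window FAMILY `(cen_w, ρ_w, A₂ʷ)` and a flatness `ε₁` that may be `0`.
THIS FILE composes that door into the SAME five-slot conclusions: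
* §0 `pinned_row_le_slotsTCC₀`, `pinned_row_le_slots_shiftTCC₀` — k3c2-p2's slot readings of `klmsRowBoundTCC` with `0 ≤ r` (zero transfer included);
* §1 `klpc_scaled_div_L_le` (a constant `X` with the SCALE-FREE datum `X·Λ_m ≤ x`, `m ≤ n_β+1`, over the registered volume `klEngL₄ ≤ L`:
  `X/L ≤ x·U/(2⁷²·Psq²Rsq²)·4^{−(n+1)}`), `klpc_defect_sum_eq`, `klpc_defect_le` (the defect entry `(3/π)DEF⋆`: its `I₁` part is an `l/L` quantity
  `κ′·2I₁/L`, its `K_g` part `κ′·4K_gΣ(β_c−α_c)/L` an OVERLAP-slot quantity through the scale-free datum — no n-flatness asked of `K_g`);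
* §2 **`dLine_pinned_direct_fiveSlotTCC`**, **`dLine_pinned_crossed_fiveSlotTCC`**: binders = the cell door's + `0 < U`, `klEngL₄ P R β U ≤ L`, `K_g·Λ_{m₁} ≤ kg`
  (`m₁ ≤ n_β+1`), `Σ_c(β_c − α_c) ≤ Θ`; size rows: `hz` = ZS of the `c`-row + ZS_C of the `F₁`-row (arc-weighted `I₁`) + windows `Σ_w A₂ʷ·1024·15381·ρ_w/π`
  + the three L-row coefficients (`c`-lattice, `F₁`-lattice with `kg`, defect `K_g`-part) on `4^{−(n+1)}`; `hh` = the two thermal entries; `hw : ε₁·512·15367 ≤ (KlamU)²w2⁻ⁿ`;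
  `hl : Σ_w A₂ʷ·1024·15381 + κ′·2I₁ ≤ (KlamU)²·l` (L-free, n-flat); `htt` = the two transfer entries.  Every datum that was SUP over the loop angle is now arc-weighted
  (θ-averaged) or scale-free — the cure (A″) shape; the spine «95v2» is untouched.
Pure composition + real arithmetic over landed rows; the split, the cells and the binders are hypotheses; nothing about the model's sizes is asserted; nothing asserts (X).3,
(c), K3 or superconductivity.  0 kit · 0 lit.  References: BGM 2006 §2.3–2.4 [cite: BenfattoGiulianiMastropietro2006].
-/

noncomputable section

namespace Summit.HubbardSuperconductivity.HubbardSuperconductivity.Theorems.KLRegimeSplit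

set_option linter.dupNamespace false -- summit = problem name (single-conjunct summit), D-0017

open Real Set Finset Complex Literature.MathematicalPhysics.QuantumLattice
open Literature.Probability.LatticeModels hiding torusSupNorm
open Literature.MathematicalPhysics.QuantumLattice.BandSectorCounting
open Summit.HubbardSuperconductivity.HubbardSuperconductivity.Theorems.KLProgrammeLegKernels
open Summit.HubbardSuperconductivity.HubbardSuperconductivity.Theorems.KLRegimeWick
open Summit.HubbardSuperconductivity.HubbardSuperconductivity.Theorems.TwoPointAssembly
open Summit.HubbardSuperconductivity.HubbardSuperconductivity.Theorems.DispersionFlow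
open Summit.HubbardSuperconductivity.HubbardSuperconductivity.Theorems.PerturbedFermiCurve
open Summit.HubbardSuperconductivity.HubbardSuperconductivity.Theorems.EngineV8

variable {L M : ℕ} [NeZero L] [NeZero M] (β μ : ℝ) (K : TrigPolyC4v)

/-! ## §2 The adapters -/

section AdapterTCC

variable {a' b' : ℝ} (B : BandBounds a' b') {R : RenConsts} {U : ℝ} {N : ℕ} {A : ℝ}

set_option maxHeartbeats 3200000 in
/-- **THE PINNED PAIR's DIRECT `D`-ROW IN FIVE-SLOT FORM ON ANGULAR-CELL DATA** (module docstring). -/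
theorem dLine_pinned_direct_fiveSlotTCC (hR : ∀ j, 0 ≤ R.Gfr j) (hK : FrameOK R U N μ K)
    (hAb : ∀ p : Momentum, ∀ j ≤ 2, ‖iteratedFDeriv ℝ j (frameShift K) p‖ ≤ A) (hA : 4 * A < B.Dtmin) (hA20 : 4 * A ≤ 1 / 20) (hμ : μ ≤ -0.15)
    (n : ℕ) {t : ℝ} (ht : t ∈ Icc (0 : ℝ) 1) (hβ : klBetaMin ≤ β) (hβL : β ≤ L) (hn : n + 1 ≤ nScales β + 1)
    (hM : β * (4 * klScale klE0 (n + 1)) / (2 * Real.pi) + 1 ≤ M)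
    (Wd : ℝ → FreqMomentum L M → ℝ) (hWd : Wd = fun t k => deriv (fun Λ' : ℝ => hubbardCutoffWeightCT L M β μ K Λ' k) (klScale klE0 n + t * (klScale klE0 (n + 1) - klScale klE0 n)))
    (V : ℕ → ℝ → (Fin 4 → HubbardFieldIdx L M) → ℂ) {j : ℕ} (hj : n + 2 ≤ j) (Qm x y : TorusSite 2 L)
    (hlo : a' < μ - 4 * klScale klE0 (n + 1) - 4 * A) (hhi : μ + 4 * klScale klE0 (n + 1) + 4 * A < b')
    (hq : (4 + 8 / 3 * R.Gfr 1 * U ^ 2) * klTorusNorm L (x - y) ≤ klScale klE0 (n + 1) / 8)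
    (c : ℂ) (F₁ : FreqMomentum L M → Fin 2 → FreqMomentum L M → ℂ) {ι' : Type*} [Fintype ι'] (F₂ : ι' → FreqMomentum L M → Fin 2 → FreqMomentum L M → ℂ)
    (F₁₀ : TorusSite 2 L → Fin 2 → TorusSite 2 L → ℂ)
    (hsplit : ∀ (p : FreqMomentum L M) (σ : Fin 2) (p' : FreqMomentum L M),
      V j t ![((p, σ), 1), ((p', σ), 0), (((omega0 M, y), 0), 0), (((omega0 M, x), 0), 1)] *
          V j t ![((p, σ), 0), ((p', σ), 1), ((((omega0 M).rev, Qm - y), 1), 0), ((((omega0 M).rev, Qm - x), 1), 1)] = c + F₁ p σ p' + ∑ w, F₂ w p σ p')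
    {A₁ Kg ε₁ : ℝ} (hA1 : 0 ≤ A₁) (hKg : 0 ≤ Kg) (hε1 : 0 ≤ ε₁)
    (hY0p₁ : ∀ k : TorusSite 2 L, ‖∑ σ : Fin 2, F₁₀ k σ (k + (x - y))‖ ≤ A₁)
    (hY1p₁ : ∀ k k' : TorusSite 2 L, ‖(∑ σ : Fin 2, F₁₀ k σ (k + (x - y))) - ∑ σ : Fin 2, F₁₀ k' σ (k' + (x - y))‖ ≤ Kg * klTorusNorm L (k - k'))
    (hY0m₁ : ∀ k : TorusSite 2 L, ‖∑ σ : Fin 2, F₁₀ (k + -(x - y)) σ k‖ ≤ A₁)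
    (hY1m₁ : ∀ k k' : TorusSite 2 L, ‖(∑ σ : Fin 2, F₁₀ (k + -(x - y)) σ k) - ∑ σ : Fin 2, F₁₀ (k' + -(x - y)) σ k'‖ ≤ Kg * klTorusNorm L (k - k'))
    {ι : Type*} [Fintype ι] {S : ι → Finset (TorusSite 2 L)} {αc βc Lc : ι → ℝ} (hαβ : ∀ c, αc c ≤ βc c) (hLc : ∀ c, 0 ≤ Lc c)
    {r : ℝ} (hr : 4 * klScale klE0 (n + 1) / (B.Dtmin - 4 * A) + Real.pi / L ≤ r)
    (hserve : ∀ c, ∀ θ ∈ Icc (αc c) (βc c), ∀ k : TorusSite 2 L,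
      torusSupNorm (klpeP L k -
        (perturbedFermiRadius (fun k : Fin 2 → ℝ => frameShift K (WithLp.toLp 2 k)) μ θ * Real.cos θ,
          perturbedFermiRadius (fun k : Fin 2 → ℝ => frameShift K (WithLp.toLp 2 k)) μ θ * Real.sin θ)) ≤ r → k ∈ S c)
    (hcover : ∀ θ ∈ Ioo (-π) π, ∃ c, θ ∈ Icc (αc c) (βc c))
    (hcellp : ∀ c, ∀ k ∈ S c, ∀ k' ∈ S c, ‖(∑ σ : Fin 2, F₁₀ k σ (k + (x - y))) - ∑ σ : Fin 2, F₁₀ k' σ (k' + (x - y))‖ ≤ Lc c * klTorusNorm L (k - k'))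
    (hcellm : ∀ c, ∀ k ∈ S c, ∀ k' ∈ S c, ‖(∑ σ : Fin 2, F₁₀ (k + -(x - y)) σ k) - ∑ σ : Fin 2, F₁₀ (k' + -(x - y)) σ k'‖ ≤ Lc c * klTorusNorm L (k - k'))
    (hflat₁ : ∀ (i : MatsubaraIdx M) (σ : Fin 2) (k k' : TorusSite 2 L), matsubaraFreq β M i ^ 2 ≤ (4 * klScale klE0 (n + 1)) ^ 2 →
      ‖F₁ (i, k) σ (i, k') - F₁₀ k σ k'‖ ≤ ε₁)
    (cen : ι' → TorusSite 2 L) {ρ A₂ : ι' → ℝ} (hρ : ∀ w, 0 ≤ ρ w) (hA2 : ∀ w, 0 ≤ A₂ w)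
    (hF₂ : ∀ w (p : FreqMomentum L M) (σ : Fin 2) (p' : FreqMomentum L M), ‖F₂ w p σ p'‖ ≤ A₂ w)
    (hsupp₂ : ∀ w (p : FreqMomentum L M) (σ : Fin 2) (p' : FreqMomentum L M), ρ w < klTorusNorm L (p.2 - cen w) → F₂ w p σ p' = 0)
    {P : SplitConsts} {zD hD wD lD tD : ℝ} (hU : 0 < U) (hL4 : klEngL₄ P R β U ≤ L) {kg Θ : ℝ} {m₁ : ℕ} (hm₁ : m₁ ≤ nScales β + 1)
    (hKgm : Kg * klScale klE0 m₁ ≤ kg) (hΘ : ∑ c, (βc c - αc c) ≤ Θ)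
    (hz : 3 / π * (64 / Real.pi * 8 *
              (Real.pi * Real.sqrt 2 / (B.Dtmin - 4 * A) * (2 * 0 + 2 * (2 * ‖c‖) * (2 / (1 / 10))) / (B.Dtmin - 4 * A) +
                2 * (2 * ‖c‖) * (1 / (B.Dtmin - 4 * A) ^ 2 + Real.pi * Real.sqrt 2 * (2 + 4 * A) / (B.Dtmin - 4 * A) ^ 3))) *
          klE0 * ((4 : ℝ) ^ (n + 1))⁻¹ +
        3 / π * (64 / Real.pi * 8 *
              (Real.pi * Real.sqrt 2 / (B.Dtmin - 4 * A) / (B.Dtmin - 4 * A) * ((∑ c, Lc c * (βc c - αc c)) / (2 * π)) +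
                Real.pi * Real.sqrt 2 / (B.Dtmin - 4 * A) * (2 * A₁ * (2 / (1 / 10))) / (B.Dtmin - 4 * A) +
                2 * A₁ * (1 / (B.Dtmin - 4 * A) ^ 2 + Real.pi * Real.sqrt 2 * (2 + 4 * A) / (B.Dtmin - 4 * A) ^ 3))) *
          klE0 * ((4 : ℝ) ^ (n + 1))⁻¹ +
        ∑ w, A₂ w * (1024 * 15381) * (ρ w / π) +
        ((0 + (2 * ‖c‖) * (4 + 8 / 3 * R.Gfr 1 * U ^ 2) * ((9 * (2 * (448 / 3 * Real.exp 2) + 8) + 4 * 8) + (3 * (8 * (16 : ℝ)) + 512 * 1))) * U / (2 ^ 52 * klEngPsq P ^ 2 * klEngRsq R ^ 2) + (kg + A₁ * (4 + 8 / 3 * R.Gfr 1 * U ^ 2) * ((9 * (2 * (448 / 3 * Real.exp 2) + 8) + 4 * 8) + (3 * (8 * (16 : ℝ)) + 512 * 1))) * U / (2 ^ 48 * klEngPsq P ^ 2 * klEngRsq R ^ 2) + 3 / π * (128 / Real.pi * 8 * (Real.pi * Real.sqrt 2 / (B.Dtmin - 4 * A))) / 2 * (4 * Θ) * (kg * U /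 (2 ^ 72 * (klEngPsq P ^ 2 * klEngRsq R ^ 2)))) * ((4 : ℝ) ^ (n + 1))⁻¹ ≤
        (P.Klam * U) ^ 2 * zD * ((4 : ℝ) ^ (n + 1))⁻¹)
    (hh : 12 / π * ((393216 / Real.pi * (64 * 16 + (2 * (448 / 3 * Real.exp 2) + 8) + 64) * (2 * (2 * ‖c‖) * (Real.pi * Real.sqrt 2 / (B.Dtmin - 4 * A)))) +
            (48 / Real.pi * 8 * (2 * (2 * ‖c‖) * (Real.pi * Real.sqrt 2 / (B.Dtmin - 4 * A))) * (3 * (8 * (16 : ℝ)) + 512 * 1)) * (4 + 8 / 3 * R.Gfr 1 * U ^ 2)) *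
          ((4 : ℝ) ^ (nScales β - n))⁻¹ +
        12 / π * ((393216 / Real.pi * (64 * 16 + (2 * (448 / 3 * Real.exp 2) + 8) + 64) * (2 * A₁ * (Real.pi * Real.sqrt 2 / (B.Dtmin - 4 * A)))) +
            (48 / Real.pi * 8 * (2 * A₁ * (Real.pi * Real.sqrt 2 / (B.Dtmin - 4 * A))) * (3 * (8 * (16 : ℝ)) + 512 * 1)) * (4 + 8 / 3 * R.Gfr 1 * U ^ 2)) *
          ((4 : ℝ) ^ (nScales β - n))⁻¹ ≤ (P.Klam * U) ^ 2 * hD * ((4 : ℝ) ^ (nScales β - n))⁻¹)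
    (hw : ε₁ * (512 * 15367) ≤ (P.Klam * U) ^ 2 * wD * ((2 : ℝ) ^ n)⁻¹)
    (hl : ∑ w, A₂ w * (1024 * 15381) + 3 / π * (128 / Real.pi * 8 * (Real.pi * Real.sqrt 2 / (B.Dtmin - 4 * A))) / 2 * (2 * (∑ c, Lc c * (βc c - αc c))) ≤ (P.Klam * U) ^ 2 * lD)
    (htt : 3 / π * (64 / Real.pi * 8 * (2 * (2 * ‖c‖) * (Real.pi * Real.sqrt 2 / (B.Dtmin - 4 * A))) * (3 * (8 * (16 : ℝ)) + 512 * 1)) *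
          ((4 + 8 / 3 * R.Gfr 1 * U ^ 2) * min (klTorusNorm L (x - y) / klScale klE0 (n + 1)) (klScale klE0 (n + 1) / klTorusNorm L (x - y))) +
        3 / π * (64 / Real.pi * 8 * (2 * A₁ * (Real.pi * Real.sqrt 2 / (B.Dtmin - 4 * A))) * (3 * (8 * (16 : ℝ)) + 512 * 1)) *
          ((4 + 8 / 3 * R.Gfr 1 * U ^ 2) * min (klTorusNorm L (x - y) / klScale klE0 (n + 1)) (klScale klE0 (n + 1) / klTorusNorm L (x - y))) ≤ (P.Klam * U) ^ 2 * tD * min (klTorusNorm L (x - y) / klScale klE0 (n + 1)) (klScale klE0 (n + 1) / klTorusNorm L (x - y))) :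
    (klScale klE0 n - klScale klE0 (n + 1)) * ((β * (L : ℝ) ^ 2) ^ 3)⁻¹ *
        ‖∑ p : FreqMomentum L M, ∑ σ : Fin 2, ∑ p' : FreqMomentum L M,
          if matsubaraInt M p'.1 + matsubaraInt M (omega0 M) = matsubaraInt M p.1 + matsubaraInt M (omega0 M) ∧ p'.2 = p.2 + x - y then
            ((((((softSymbolCompl L M β μ K (n + 1) j p - softSymbolCompl L M β μ K (n + 1) (n + 1) p) : ℝ) : ℂ) * (((β * (L : ℝ) ^ 2 : ℝ) : ℂ) * propCT L M β μ K p)) *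
                  ((((Wd t p') : ℝ) : ℂ) * (((β * (L : ℝ) ^ 2 : ℝ) : ℂ) * propCT L M β μ K p'))) +
                (((((Wd t p) : ℝ) : ℂ) * (((β * (L : ℝ) ^ 2 : ℝ) : ℂ) * propCT L M β μ K p)) *
                  ((((softSymbolCompl L M β μ K (n + 1) j p' - softSymbolCompl L M β μ K (n + 1) (n + 1) p') : ℝ) : ℂ) * (((β * (L : ℝ) ^ 2 : ℝ) : ℂ) * propCT L M β μ K p')))) *
              (V j t ![((p, σ), 1), ((p', σ), 0), (((omega0 M, y), 0), 0), (((omega0 M, x), 0), 1)] *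
                V j t ![((p, σ), 0), ((p', σ), 1), ((((omega0 M).rev, Qm - y), 1), 0), ((((omega0 M).rev, Qm - x), 1), 1)])
          else 0‖ ≤
      (P.Klam * U) ^ 2 * (zD * ((4 : ℝ) ^ (n + 1))⁻¹ + hD * ((4 : ℝ) ^ (nScales β - n))⁻¹ + wD * ((2 : ℝ) ^ n)⁻¹ + lD * ((L : ℝ))⁻¹ + tD * min (klTorusNorm L (x - y) / klScale klE0 (n + 1)) (klScale klE0 (n + 1) / klTorusNorm L (x - y))) := by
  have hβ0 : 0 < β := lt_of_lt_of_le (by norm_num [klBetaMin]) hβ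
  have hdoor := dLine_pinned_direct_splitCells_doorTC β μ K B hR hK hAb hA hA20 hμ n ht hβ hβL hn hM Wd hWd V hj Qm x y hlo hhi hq c F₁ F₂ F₁₀ hsplit hA1 hKg hε1 hY0p₁ hY1p₁ hY0m₁ hY1m₁ hαβ hLc hr hserve hcover hcellp hcellm hflat₁ cen hρ hA2 hF₂ hsupp₂
  have hr0 : 0 ≤ klTorusNorm L (x - y) := torusSupNorm_nonneg _
  have hA0 : 0 ≤ A := (norm_nonneg _).trans (hAb 0 0 (by norm_num))
  have hdA : 0 < B.Dtmin - 4 * A := by linarith only [hA]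
  have hnβ : n ≤ nScales β := by omega
  have hGfr : 0 ≤ R.Gfr 1 := hR 1
  have hG0 : 0 ≤ (4 + 8 / 3 * R.Gfr 1 * U ^ 2) := by nlinarith [sq_nonneg U]
  have hG4 : 4 ≤ (4 + 8 / 3 * R.Gfr 1 * U ^ 2) := by nlinarith [sq_nonneg U]
  have hrΛ : klTorusNorm L (x - y) ≤ klScale klE0 (n + 1) := by
    have h4 := mul_le_mul_of_nonneg_right hG4 hr0
    linarith only [hq, h4, klth_klScale_pos (n + 1)]
  have hA0c : (0 : ℝ) ≤ (2 * ‖c‖) := by positivity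
  have hI1 : (0 : ℝ) ≤ (∑ c, Lc c * (βc c - αc c)) := Finset.sum_nonneg fun c _ => mul_nonneg (hLc c) (sub_nonneg.2 (hαβ c))
  have hIδ : (0 : ℝ) ≤ (∑ c, (2 * Lc c + 4 * Kg) * (Real.pi / L) * (βc c - αc c)) := Finset.sum_nonneg fun c _ => by
    have := hLc c; have := sub_nonneg.2 (hαβ c); positivity
  have hC0 : (0 : ℝ) ≤ ((9 * (2 * (448 / 3 * Real.exp 2) + 8) + 4 * 8) + (3 * (8 * (16 : ℝ)) + 512 * 1)) := by positivity
  have hLpos : (0 : ℝ) < L := by exact_mod_cast pos_of_klEngL₄_le hL4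
  have hΘ0 : ∑ c, (βc c - αc c) ≤ Θ := hΘ
  have hS0 : 0 ≤ ∑ c, (βc c - αc c) := Finset.sum_nonneg fun c _ => sub_nonneg.2 (hαβ c)
  have hkg0 : 0 ≤ kg := le_trans (mul_nonneg hKg (klth_klScale_pos m₁).le) hKgm
  -- the lattice entries (L-rows) and the defect entry
  have hlat_c := klpl_lattice_row_le_overlap (P := P) (R := R) hβ hU hL4 hnβ (La := 0) le_rfl hA0c hG0 hC0
  have hlat_F := klpl_lattice_row_le_overlap_scaled (P := P) (R := R) hβ hU hL4 hnβ hm₁ hKg hKgm hA1 hG0 hC0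
  have hKgL := klpc_scaled_div_L_le (P := P) (R := R) hβ hU hL4 hnβ hm₁ hKg hKgm
  have hdef := klpc_defect_le (Lc := Lc) (B.Dtmin - 4 * A) hdA hLpos hKg hαβ hΘ hKgL
  have hslots_c := pinned_row_le_slotsTC₀ (L := L) (β := β) (G := (4 + 8 / 3 * R.Gfr 1 * U ^ 2)) (La := 0) hdA hA0 hG0 hA0c le_rfl hβ hnβ hr0 hrΛ
  have hslots_F := pinned_row_le_slotsTCC₀ (L := L) (β := β) (G := (4 + 8 / 3 * R.Gfr 1 * U ^ 2)) (Kg := Kg) hdA hA0 hG0 hA1 hI1 hIδ hβ hnβ hr0 hrΛ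
  have hlL : (∑ w, A₂ w * (1024 * 15381) + 3 / π * (128 / Real.pi * 8 * (Real.pi * Real.sqrt 2 / (B.Dtmin - 4 * A))) / 2 * (2 * (∑ c, Lc c * (βc c - αc c)))) * ((L : ℝ))⁻¹ ≤ (P.Klam * U) ^ 2 * lD * ((L : ℝ))⁻¹ :=
    mul_le_mul_of_nonneg_right hl (inv_nonneg.mpr hLpos.le)
  have eW : ∑ w, A₂ w * (1024 * 15381) * (ρ w / π + ((L : ℝ))⁻¹) =
      ∑ w, A₂ w * (1024 * 15381) * (ρ w / π) + (∑ w, A₂ w * (1024 * 15381)) * ((L : ℝ))⁻¹ := by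
    rw [Finset.sum_mul, ← Finset.sum_add_distrib]; exact Finset.sum_congr rfl fun w _ => by ring
  have eL : (∑ w, A₂ w * (1024 * 15381) + 3 / π * (128 / Real.pi * 8 * (Real.pi * Real.sqrt 2 / (B.Dtmin - 4 * A))) / 2 * (2 * (∑ c, Lc c * (βc c - αc c)))) * ((L : ℝ))⁻¹ =
      (∑ w, A₂ w * (1024 * 15381)) * ((L : ℝ))⁻¹ + 3 / π * (128 / Real.pi * 8 * (Real.pi * Real.sqrt 2 / (B.Dtmin - 4 * A))) / 2 * (2 * (∑ c, Lc c * (βc c - αc c))) / L := by ring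
  have e5 : (P.Klam * U) ^ 2 * (zD * ((4 : ℝ) ^ (n + 1))⁻¹ + hD * ((4 : ℝ) ^ (nScales β - n))⁻¹ + wD * ((2 : ℝ) ^ n)⁻¹ + lD * ((L : ℝ))⁻¹ + tD * min (klTorusNorm L (x - y) / klScale klE0 (n + 1)) (klScale klE0 (n + 1) / klTorusNorm L (x - y))) =
      (P.Klam * U) ^ 2 * zD * ((4 : ℝ) ^ (n + 1))⁻¹ + (P.Klam * U) ^ 2 * hD * ((4 : ℝ) ^ (nScales β - n))⁻¹ + (P.Klam * U) ^ 2 * wD * ((2 : ℝ) ^ n)⁻¹ +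
        (P.Klam * U) ^ 2 * lD * ((L : ℝ))⁻¹ + (P.Klam * U) ^ 2 * tD * min (klTorusNorm L (x - y) / klScale klE0 (n + 1)) (klScale klE0 (n + 1) / klTorusNorm L (x - y)) := by ring
  rw [e5]
  linarith only [hdoor, hslots_c, hslots_F, hz, hh, hw, hlL, hlat_c, hlat_F, hdef, htt, eW, eL]

set_option maxHeartbeats 3200000 in
/-- **THE PINNED PAIR's CROSSED `D`-ROW IN FIVE-SLOT FORM ON ANGULAR-CELL DATA** (module docstring). -/
theorem dLine_pinned_crossed_fiveSlotTCC (hR : ∀ j, 0 ≤ R.Gfr j) (hK : FrameOK R U N μ K)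
    (hAb : ∀ p : Momentum, ∀ j ≤ 2, ‖iteratedFDeriv ℝ j (frameShift K) p‖ ≤ A) (hA : 4 * A < B.Dtmin) (hA20 : 4 * A ≤ 1 / 20) (hμ : μ ≤ -0.15)
    (n : ℕ) {t : ℝ} (ht : t ∈ Icc (0 : ℝ) 1) (hβ : klBetaMin ≤ β) (hβL : β ≤ L) (hn : n + 1 ≤ nScales β + 1) (hβn : 16 * π / β ≤ klScale klE0 (n + 1))
    (hM : β * (4 * klScale klE0 (n + 1)) / (2 * Real.pi) + 1 ≤ M)
    (Wd : ℝ → FreqMomentum L M → ℝ) (hWd : Wd = fun t k => deriv (fun Λ' : ℝ => hubbardCutoffWeightCT L M β μ K Λ' k) (klScale klE0 n + t * (klScale klE0 (n + 1) - klScale klE0 n)))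
    (V : ℕ → ℝ → (Fin 4 → HubbardFieldIdx L M) → ℂ) {j : ℕ} (hj : n + 2 ≤ j) (Qm x y : TorusSite 2 L)
    (hlo : a' < μ - 4 * klScale klE0 (n + 1) - 4 * A) (hhi : μ + 4 * klScale klE0 (n + 1) + 4 * A < b')
    (hq : (4 + 8 / 3 * R.Gfr 1 * U ^ 2) * klTorusNorm L (Qm - x - y) ≤ klScale klE0 (n + 1) / 16)
    (c : ℂ) (F₁ : FreqMomentum L M → FreqMomentum L M → ℂ) {ι' : Type*} [Fintype ι'] (F₂ : ι' → FreqMomentum L M → FreqMomentum L M → ℂ)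
    (F₁₀ : TorusSite 2 L → TorusSite 2 L → ℂ)
    (hsplit : ∀ (p p' : FreqMomentum L M),
      V j t ![((p, 0), 1), ((p', 1), 0), (((omega0 M, y), 0), 0), ((((omega0 M).rev, Qm - x), 1), 1)] *
          V j t ![((p, 0), 0), ((p', 1), 1), ((((omega0 M).rev, Qm - y), 1), 0), (((omega0 M, x), 0), 1)] = c + F₁ p p' + ∑ w, F₂ w p p')
    {A₁ Kg ε₁ : ℝ} (hA1 : 0 ≤ A₁) (hKg : 0 ≤ Kg) (hε1 : 0 ≤ ε₁)
    (hY0B₁ : ∀ k : TorusSite 2 L, ‖F₁₀ k (k + (Qm - x - y))‖ ≤ A₁)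
    (hY1B₁ : ∀ k k' : TorusSite 2 L, ‖F₁₀ k (k + (Qm - x - y)) - F₁₀ k' (k' + (Qm - x - y))‖ ≤ Kg * klTorusNorm L (k - k'))
    (hY0A₁ : ∀ k : TorusSite 2 L, ‖F₁₀ (k + -(Qm - x - y)) k‖ ≤ A₁)
    (hY1A₁ : ∀ k k' : TorusSite 2 L, ‖F₁₀ (k + -(Qm - x - y)) k - F₁₀ (k' + -(Qm - x - y)) k'‖ ≤ Kg * klTorusNorm L (k - k'))
    {ι : Type*} [Fintype ι] {S : ι → Finset (TorusSite 2 L)} {αc βc Lc : ι → ℝ} (hαβ : ∀ c, αc c ≤ βc c) (hLc : ∀ c, 0 ≤ Lc c)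
    {r : ℝ} (hr : 4 * klScale klE0 (n + 1) / (B.Dtmin - 4 * A) + Real.pi / L ≤ r)
    (hserve : ∀ c, ∀ θ ∈ Icc (αc c) (βc c), ∀ k : TorusSite 2 L,
      torusSupNorm (klpeP L k -
        (perturbedFermiRadius (fun k : Fin 2 → ℝ => frameShift K (WithLp.toLp 2 k)) μ θ * Real.cos θ,
          perturbedFermiRadius (fun k : Fin 2 → ℝ => frameShift K (WithLp.toLp 2 k)) μ θ * Real.sin θ)) ≤ r → k ∈ S c)
    (hcover : ∀ θ ∈ Ioo (-π) π, ∃ c, θ ∈ Icc (αc c) (βc c))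
    (hcellB : ∀ c, ∀ k ∈ S c, ∀ k' ∈ S c, ‖F₁₀ k (k + (Qm - x - y)) - F₁₀ k' (k' + (Qm - x - y))‖ ≤ Lc c * klTorusNorm L (k - k'))
    (hcellA : ∀ c, ∀ k ∈ S c, ∀ k' ∈ S c, ‖F₁₀ (k + -(Qm - x - y)) k - F₁₀ (k' + -(Qm - x - y)) k'‖ ≤ Lc c * klTorusNorm L (k - k'))
    (hflat₁ : ∀ (i i' : MatsubaraIdx M) (k k' : TorusSite 2 L), matsubaraInt M i' + 1 = matsubaraInt M i →
      matsubaraFreq β M i ^ 2 ≤ (5 * klScale klE0 (n + 1)) ^ 2 → ‖F₁ (i, k) (i', k') - F₁₀ k k'‖ ≤ ε₁)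
    (cen : ι' → TorusSite 2 L) {ρ A₂ : ι' → ℝ} (hρ : ∀ w, 0 ≤ ρ w) (hA2 : ∀ w, 0 ≤ A₂ w)
    (hF₂ : ∀ w (p p' : FreqMomentum L M), ‖F₂ w p p'‖ ≤ A₂ w)
    (hsupp₂ : ∀ w (p p' : FreqMomentum L M), ρ w < klTorusNorm L (p.2 - cen w) → F₂ w p p' = 0)
    {P : SplitConsts} {zX hX wX lX tX : ℝ} (hU : 0 < U) (hL4 : klEngL₄ P R β U ≤ L) {kg Θ : ℝ} {m₁ : ℕ} (hm₁ : m₁ ≤ nScales β + 1)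
    (hKgm : Kg * klScale klE0 m₁ ≤ kg) (hΘ : ∑ c, (βc c - αc c) ≤ Θ)
    (hz : 3 / π * (64 / Real.pi * 8 *
              (Real.pi * Real.sqrt 2 / (B.Dtmin - 4 * A) * (2 * 0 + 2 * ‖c‖ * (2 / (1 / 10))) / (B.Dtmin - 4 * A) +
                2 * ‖c‖ * (1 / (B.Dtmin - 4 * A) ^ 2 + Real.pi * Real.sqrt 2 * (2 + 4 * A) / (B.Dtmin - 4 * A) ^ 3))) *
          klE0 * ((4 : ℝ) ^ (n + 1))⁻¹ +
        3 / π * (64 / Real.pi * 8 *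
              (Real.pi * Real.sqrt 2 / (B.Dtmin - 4 * A) / (B.Dtmin - 4 * A) * ((∑ c, Lc c * (βc c - αc c)) / (2 * π)) +
                Real.pi * Real.sqrt 2 / (B.Dtmin - 4 * A) * (2 * A₁ * (2 / (1 / 10))) / (B.Dtmin - 4 * A) +
                2 * A₁ * (1 / (B.Dtmin - 4 * A) ^ 2 + Real.pi * Real.sqrt 2 * (2 + 4 * A) / (B.Dtmin - 4 * A) ^ 3))) *
          klE0 * ((4 : ℝ) ^ (n + 1))⁻¹ +
        ∑ w, A₂ w * (1024 * 15381) * (ρ w / π) +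
        ((0 + ‖c‖ * (4 + 8 / 3 * R.Gfr 1 * U ^ 2) * ((9 * (2 * (448 / 3 * Real.exp 2) + 8) + 4 * 8) + (3 * (8 * (16 : ℝ)) + 512 * 1))) * U / (2 ^ 52 * klEngPsq P ^ 2 * klEngRsq R ^ 2) + (kg + A₁ * (4 + 8 / 3 * R.Gfr 1 * U ^ 2) * ((9 * (2 * (448 / 3 * Real.exp 2) + 8) + 4 * 8) + (3 * (8 * (16 : ℝ)) + 512 * 1))) * U / (2 ^ 48 * klEngPsq P ^ 2 * klEngRsq R ^ 2) + 3 / π * (128 / Real.pi * 8 * (Real.pi * Real.sqrt 2 / (B.Dtmin - 4 * A))) / 2 * (4 * Θ) * (kg * U / (2 ^ 72 * (klEngPsq P ^ 2 * klEngRsq R ^ 2)))) * ((4 : ℝ) ^ (n + 1))⁻¹ ≤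
        (P.Klam * U) ^ 2 * zX * ((4 : ℝ) ^ (n + 1))⁻¹)
    (hh : 12 / π * ((393216 / Real.pi * (64 * 16 + (2 * (448 / 3 * Real.exp 2) + 8) + 64) * (2 * ‖c‖ * (Real.pi * Real.sqrt 2 / (B.Dtmin - 4 * A)))) +
            2 * (64 / Real.pi * 8 * (2 * ‖c‖ * (Real.pi * Real.sqrt 2 / (B.Dtmin - 4 * A))) * (3 * (8 * (16 : ℝ)) + 512 * 1)) +
            8 * (48 / Real.pi * 8 * (2 * ‖c‖ * (Real.pi * Real.sqrt 2 / (B.Dtmin - 4 * A))) * (3 * (8 * (16 : ℝ)) + 512 * 1)) +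
            (48 / Real.pi * 8 * (2 * ‖c‖ * (Real.pi * Real.sqrt 2 / (B.Dtmin - 4 * A))) * (3 * (8 * (16 : ℝ)) + 512 * 1)) * (4 + 8 / 3 * R.Gfr 1 * U ^ 2)) *
          ((4 : ℝ) ^ (nScales β - n))⁻¹ +
        12 / π * ((393216 / Real.pi * (64 * 16 + (2 * (448 / 3 * Real.exp 2) + 8) + 64) * (2 * A₁ * (Real.pi * Real.sqrt 2 / (B.Dtmin - 4 * A)))) +
            2 * (64 / Real.pi * 8 * (2 * A₁ * (Real.pi * Real.sqrt 2 / (B.Dtmin - 4 * A))) * (3 * (8 * (16 : ℝ)) + 512 * 1)) +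
            8 * (48 / Real.pi * 8 * (2 * A₁ * (Real.pi * Real.sqrt 2 / (B.Dtmin - 4 * A))) * (3 * (8 * (16 : ℝ)) + 512 * 1)) +
            (48 / Real.pi * 8 * (2 * A₁ * (Real.pi * Real.sqrt 2 / (B.Dtmin - 4 * A))) * (3 * (8 * (16 : ℝ)) + 512 * 1)) * (4 + 8 / 3 * R.Gfr 1 * U ^ 2)) *
          ((4 : ℝ) ^ (nScales β - n))⁻¹ ≤ (P.Klam * U) ^ 2 * hX * ((4 : ℝ) ^ (nScales β - n))⁻¹)
    (hw : ε₁ * (512 * 15367) ≤ (P.Klam * U) ^ 2 * wX * ((2 : ℝ) ^ n)⁻¹)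
    (hl : ∑ w, A₂ w * (1024 * 15381) + 3 / π * (128 / Real.pi * 8 * (Real.pi * Real.sqrt 2 / (B.Dtmin - 4 * A))) / 2 * (2 * (∑ c, Lc c * (βc c - αc c))) ≤ (P.Klam * U) ^ 2 * lX)
    (htt : 3 / π * (64 / Real.pi * 8 * (2 * ‖c‖ * (Real.pi * Real.sqrt 2 / (B.Dtmin - 4 * A))) * (3 * (8 * (16 : ℝ)) + 512 * 1)) *
          ((4 + 8 / 3 * R.Gfr 1 * U ^ 2) * min (klTorusNorm L (Qm - x - y) / klScale klE0 (n + 1)) (klScale klE0 (n + 1) / klTorusNorm L (Qm - x - y))) +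
        3 / π * (64 / Real.pi * 8 * (2 * A₁ * (Real.pi * Real.sqrt 2 / (B.Dtmin - 4 * A))) * (3 * (8 * (16 : ℝ)) + 512 * 1)) *
          ((4 + 8 / 3 * R.Gfr 1 * U ^ 2) * min (klTorusNorm L (Qm - x - y) / klScale klE0 (n + 1)) (klScale klE0 (n + 1) / klTorusNorm L (Qm - x - y))) ≤ (P.Klam * U) ^ 2 * tX * min (klTorusNorm L (Qm - x - y) / klScale klE0 (n + 1)) (klScale klE0 (n + 1) / klTorusNorm L (Qm - x - y))) :
    (klScale klE0 n - klScale klE0 (n + 1)) * ((β * (L : ℝ) ^ 2) ^ 3)⁻¹ *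
        ‖∑ p : FreqMomentum L M, ∑ p' : FreqMomentum L M,
          if matsubaraInt M p'.1 + matsubaraInt M (omega0 M) + matsubaraInt M (omega0 M) + 1 = matsubaraInt M p.1 ∧ p'.2 = p.2 + Qm - x - y then
            ((((((softSymbolCompl L M β μ K (n + 1) j p - softSymbolCompl L M β μ K (n + 1) (n + 1) p) : ℝ) : ℂ) * (((β * (L : ℝ) ^ 2 : ℝ) : ℂ) * propCT L M β μ K p)) *
                  ((((Wd t p') : ℝ) : ℂ) * (((β * (L : ℝ) ^ 2 : ℝ) : ℂ) * propCT L M β μ K p'))) +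
                (((((Wd t p) : ℝ) : ℂ) * (((β * (L : ℝ) ^ 2 : ℝ) : ℂ) * propCT L M β μ K p)) *
                  ((((softSymbolCompl L M β μ K (n + 1) j p' - softSymbolCompl L M β μ K (n + 1) (n + 1) p') : ℝ) : ℂ) * (((β * (L : ℝ) ^ 2 : ℝ) : ℂ) * propCT L M β μ K p')))) *
              (V j t ![((p, 0), 1), ((p', 1), 0), (((omega0 M, y), 0), 0), ((((omega0 M).rev, Qm - x), 1), 1)] *
                V j t ![((p, 0), 0), ((p', 1), 1), ((((omega0 M).rev, Qm - y), 1), 0), (((omega0 M, x), 0), 1)])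
          else 0‖ ≤
      (P.Klam * U) ^ 2 * (zX * ((4 : ℝ) ^ (n + 1))⁻¹ + hX * ((4 : ℝ) ^ (nScales β - n))⁻¹ + wX * ((2 : ℝ) ^ n)⁻¹ + lX * ((L : ℝ))⁻¹ + tX * min (klTorusNorm L (Qm - x - y) / klScale klE0 (n + 1)) (klScale klE0 (n + 1) / klTorusNorm L (Qm - x - y))) := by
  have hβ0 : 0 < β := lt_of_lt_of_le (by norm_num [klBetaMin]) hβ
  have hdoor := dLine_pinned_crossed_splitCells_doorTC β μ K B hR hK hAb hA hA20 hμ n ht hβ hβL hn hβn hM Wd hWd V hj Qm x y hlo hhi hq c F₁ F₂ F₁₀ hsplit hA1 hKg hε1 hY0B₁ hY1B₁ hY0A₁ hY1A₁ hαβ hLc hr hserve hcover hcellB hcellA hflat₁ cen hρ hA2 hF₂ hsupp₂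
  have hr0 : 0 ≤ klTorusNorm L (Qm - x - y) := torusSupNorm_nonneg _
  have hA0 : 0 ≤ A := (norm_nonneg _).trans (hAb 0 0 (by norm_num))
  have hdA : 0 < B.Dtmin - 4 * A := by linarith only [hA]
  have hnβ : n ≤ nScales β := by omega
  have hGfr : 0 ≤ R.Gfr 1 := hR 1
  have hG0 : 0 ≤ (4 + 8 / 3 * R.Gfr 1 * U ^ 2) := by nlinarith [sq_nonneg U]
  have hG4 : 4 ≤ (4 + 8 / 3 * R.Gfr 1 * U ^ 2) := by nlinarith [sq_nonneg U]
  have hrΛ : klTorusNorm L (Qm - x - y) ≤ klScale klE0 (n + 1) := by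
    have h4 := mul_le_mul_of_nonneg_right hG4 hr0
    linarith only [hq, h4, klth_klScale_pos (n + 1)]
  have hA0c : (0 : ℝ) ≤ ‖c‖ := by positivity
  have hI1 : (0 : ℝ) ≤ (∑ c, Lc c * (βc c - αc c)) := Finset.sum_nonneg fun c _ => mul_nonneg (hLc c) (sub_nonneg.2 (hαβ c))
  have hIδ : (0 : ℝ) ≤ (∑ c, (2 * Lc c + 4 * Kg) * (Real.pi / L) * (βc c - αc c)) := Finset.sum_nonneg fun c _ => by
    have := hLc c; have := sub_nonneg.2 (hαβ c); positivity
  have hC0 : (0 : ℝ) ≤ ((9 * (2 * (448 / 3 * Real.exp 2) + 8) + 4 * 8) + (3 * (8 * (16 : ℝ)) + 512 * 1)) := by positivity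
  have hLpos : (0 : ℝ) < L := by exact_mod_cast pos_of_klEngL₄_le hL4
  have hΘ0 : ∑ c, (βc c - αc c) ≤ Θ := hΘ
  have hS0 : 0 ≤ ∑ c, (βc c - αc c) := Finset.sum_nonneg fun c _ => sub_nonneg.2 (hαβ c)
  have hkg0 : 0 ≤ kg := le_trans (mul_nonneg hKg (klth_klScale_pos m₁).le) hKgm
  -- the lattice entries (L-rows) and the defect entry
  have hlat_c := klpl_lattice_row_le_overlap (P := P) (R := R) hβ hU hL4 hnβ (La := 0) le_rfl hA0c hG0 hC0
  have hlat_F := klpl_lattice_row_le_overlap_scaled (P := P) (R := R) hβ hU hL4 hnβ hm₁ hKg hKgm hA1 hG0 hC0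
  have hKgL := klpc_scaled_div_L_le (P := P) (R := R) hβ hU hL4 hnβ hm₁ hKg hKgm
  have hdef := klpc_defect_le (Lc := Lc) (B.Dtmin - 4 * A) hdA hLpos hKg hαβ hΘ hKgL
  have hsm : |-(2 * π / β)| = 2 * π / β := by rw [abs_neg, abs_of_pos (by positivity)]
  have hsp : |2 * π / β| = 2 * π / β := abs_of_pos (by positivity)
  have h1m := pinned_row_le_slots_shiftTC₀ (L := L) (β := β) (G := (4 + 8 / 3 * R.Gfr 1 * U ^ 2)) (La := 0) hdA hA0 hG0 hA0c le_rfl hβ hnβ hr0 hrΛ hsm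
  have h1p := pinned_row_le_slots_shiftTC₀ (L := L) (β := β) (G := (4 + 8 / 3 * R.Gfr 1 * U ^ 2)) (La := 0) hdA hA0 hG0 hA0c le_rfl hβ hnβ hr0 hrΛ hsp
  have h2m := pinned_row_le_slots_shiftTCC₀ (L := L) (β := β) (G := (4 + 8 / 3 * R.Gfr 1 * U ^ 2)) (Kg := Kg) hdA hA0 hG0 hA1 hI1 hIδ hβ hnβ hr0 hrΛ hsm
  have h2p := pinned_row_le_slots_shiftTCC₀ (L := L) (β := β) (G := (4 + 8 / 3 * R.Gfr 1 * U ^ 2)) (Kg := Kg) hdA hA0 hG0 hA1 hI1 hIδ hβ hnβ hr0 hrΛ hsp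
  have hlL : (∑ w, A₂ w * (1024 * 15381) + 3 / π * (128 / Real.pi * 8 * (Real.pi * Real.sqrt 2 / (B.Dtmin - 4 * A))) / 2 * (2 * (∑ c, Lc c * (βc c - αc c)))) * ((L : ℝ))⁻¹ ≤ (P.Klam * U) ^ 2 * lX * ((L : ℝ))⁻¹ :=
    mul_le_mul_of_nonneg_right hl (inv_nonneg.mpr hLpos.le)
  have eW : ∑ w, A₂ w * (1024 * 15381) * (ρ w / π + ((L : ℝ))⁻¹) =
      ∑ w, A₂ w * (1024 * 15381) * (ρ w / π) + (∑ w, A₂ w * (1024 * 15381)) * ((L : ℝ))⁻¹ := by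
    rw [Finset.sum_mul, ← Finset.sum_add_distrib]; exact Finset.sum_congr rfl fun w _ => by ring
  have eL : (∑ w, A₂ w * (1024 * 15381) + 3 / π * (128 / Real.pi * 8 * (Real.pi * Real.sqrt 2 / (B.Dtmin - 4 * A))) / 2 * (2 * (∑ c, Lc c * (βc c - αc c)))) * ((L : ℝ))⁻¹ =
      (∑ w, A₂ w * (1024 * 15381)) * ((L : ℝ))⁻¹ + 3 / π * (128 / Real.pi * 8 * (Real.pi * Real.sqrt 2 / (B.Dtmin - 4 * A))) / 2 * (2 * (∑ c, Lc c * (βc c - αc c))) / L := by ring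
  have e5 : (P.Klam * U) ^ 2 * (zX * ((4 : ℝ) ^ (n + 1))⁻¹ + hX * ((4 : ℝ) ^ (nScales β - n))⁻¹ + wX * ((2 : ℝ) ^ n)⁻¹ + lX * ((L : ℝ))⁻¹ + tX * min (klTorusNorm L (Qm - x - y) / klScale klE0 (n + 1)) (klScale klE0 (n + 1) / klTorusNorm L (Qm - x - y))) =
      (P.Klam * U) ^ 2 * zX * ((4 : ℝ) ^ (n + 1))⁻¹ + (P.Klam * U) ^ 2 * hX * ((4 : ℝ) ^ (nScales β - n))⁻¹ + (P.Klam * U) ^ 2 * wX * ((2 : ℝ) ^ n)⁻¹ +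
        (P.Klam * U) ^ 2 * lX * ((L : ℝ))⁻¹ + (P.Klam * U) ^ 2 * tX * min (klTorusNorm L (Qm - x - y) / klScale klE0 (n + 1)) (klScale klE0 (n + 1) / klTorusNorm L (Qm - x - y)) := by ring
  rw [e5]
  linarith only [hdoor, h1m, h1p, h2m, h2p, hz, hh, hw, hlL, hlat_c, hlat_F, hdef, htt, eW, eL]

end AdapterTCC

end Summit.HubbardSuperconductivity.HubbardSuperconductivity.Theorems.KLRegimeSplit

end
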